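import Summits.KontsevichZagierPeriods.KontsevichZagierPeriods.Theorems.TerasomaMultiplicationBetaCancellationStubTameFormAux19
import Summits.KontsevichZagierPeriods.KontsevichZagierPeriods.Theorems.TerasomaMultiplicationBetaCancellationStubTameFormAux20
import Summits.KontsevichZagierPeriods.KontsevichZagierPeriods.Theorems.TerasomaMultiplicationBetaCancellationStubTameFormAux27

/-!
# `BetaCancellation` (stmt-KontsevichZagierPeriods-13633), line `divisor-slicing-transshipment` — stub `stub_tameForm`

**One-bijection normal form with catalytic spectator** (crux NOTES seat c6, "F13"). For the Cauchy
line `K = [ℝ, 1/(1+x²)]` and a certificate `[K × r] − [K × r'] ∈ KZ.relations`: the `K₀`-shadow of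
every relation vanishes (`shadow_of_mem_relations` with the four move sets, auxiliary files 7–12 and
21–27), so `[K × r] − [K × r']` has vanishing shadow; extracting the normal form with common spectator
(file 14), stabilising (file 18), absorbing the spectator into catalytic cylinders (files 15, 19) and
realising the two sides by representations `A`, `B` (files 17, 20) gives positive `A`, `B` with
`[r] − [r'] ≡ [A] − [B]` and a finite piecewise `ℚ`-semialgebraic measure isomorphism
`K × A ≅ K × B` in the literal format of the stub.

References: M. Kontsevich, D. Zagier, *Periods* (2001), §1.2; crux NOTES c6 (F13).
-/

noncomputable section

-- `Summit.KontsevichZagierPeriods.KontsevichZagierPeriods.…` is the tree's mandated layout (single-conjunct summit).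
set_option linter.dupNamespace false

namespace Summit.KontsevichZagierPeriods.KontsevichZagierPeriods.BetaCancellationDivisorSlicing

open MeasureTheory Set Function
open Literature.NumberTheory.Transcendental
open Literature.NumberTheory.Transcendental.KZ
open Literature.ModelTheory.ExponentialFields (IsSemialgebraic isSemialgebraic_univ)

/-- **Every relation of the Kontsevich–Zagier calculus has vanishing `K₀`-shadow.** [folklore] -/
theorem shadow_of_relations {c : FormalRep} (hc : c ∈ relations) : Nonempty (Shadow c) := by
  refine shadow_of_mem_relations (fun c hc => ?_) hc
  rcases hc with ((hc | hc) | hc) | hc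
  · exact Shadow.of_mem_domainAddRel hc
  · exact Shadow.of_mem_integrandAddRel hc
  · exact Shadow.of_mem_changeOfVariablesRel hc
  · exact Shadow.of_mem_newtonLeibnizRel hc

variable {n m : ℕ}

/-- Catalytic products by the Cauchy line determine the second factor. [folklore] -/
theorem eq_of_prod_eq (K : IntegralRep 1) (hKd : K.domain = Set.univ)
    (hKi : Set.EqOn K.integrand (fun x => 1 / (1 + x 0 ^ 2)) K.domain) (r r' : IntegralRep n)
    (h : K.prod r = K.prod r') : r = r' := by
  have hd : r.domain = r'.domain := by
    ext y
    have := congrArg (fun X : IntegralRep (1 + n) => (Fin.append (0 : Fin 1 → ℝ) y : Fin (1 + n) → ℝ) ∈ X.domain) h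
    simpa [IntegralRep.prod_domain, hKd] using this
  have hi : r.integrand = r'.integrand := by
    funext y
    have := congrArg (fun X : IntegralRep (1 + n) => X.integrand (Fin.append (0 : Fin 1 → ℝ) y)) h
    simp only [IntegralRep.prod_integrand_eq, IntegralRep.prodFun_append] at this
    have hK : K.integrand 0 ≠ 0 := (cauchy_pos K hKd hKi 0).ne'
    exact mul_left_cancel₀ hK this
  exact IntegralRep.ext' hd hi

/-- The degenerate case `K × r = K × r'` of the stub: empty `A = B`. [folklore] -/
theorem tameForm_of_eq (r : IntegralRep n) :
    ∃ (d : ℕ) (A B : IntegralRep d), (∀ a ∈ A.domain, 0 < A.integrand a) ∧ (∀ b ∈ B.domain, 0 < B.integrand b) ∧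
      of r - of r - (of A - of B) ∈ relations ∧ ∃ (J : ℕ) (S : Fin J → Set (Fin (1 + d) → ℝ))
        (Ψ : Fin J → (Fin (1 + d) → ℝ) → (Fin (1 + d) → ℝ))
        (Ψ' : Fin J → (Fin (1 + d) → ℝ) → ((Fin (1 + d) → ℝ) →L[ℝ] (Fin (1 + d) → ℝ))),
        (∀ j, IsSemialgebraic ℚ (S j) ∧ S j ⊆ {z | (fun i => z (Fin.natAdd 1 i)) ∈ A.domain} ∧
          IsSemialgebraicMapOn ℚ (S j) (Ψ j) ∧ Set.InjOn (Ψ j) (S j) ∧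
          (∀ z ∈ S j, HasFDerivWithinAt (Ψ j) (Ψ' j z) (S j) z) ∧
          Ψ j '' S j ⊆ {z | (fun i => z (Fin.natAdd 1 i)) ∈ B.domain} ∧
          ∀ z ∈ S j, 1 / (1 + z (Fin.castAdd d 0) ^ 2) * A.integrand (fun i => z (Fin.natAdd 1 i)) =
            1 / (1 + (Ψ j z) (Fin.castAdd d 0) ^ 2) * B.integrand (fun i => (Ψ j z) (Fin.natAdd 1 i)) *
              |(Ψ' j z).det|) ∧
        (∀ j j', j ≠ j' → volume (S j ∩ S j') = 0 ∧ volume (Ψ j '' S j ∩ Ψ j' '' S j') = 0) ∧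
        volume ({z : Fin (1 + d) → ℝ | (fun i => z (Fin.natAdd 1 i)) ∈ A.domain} \ ⋃ j, S j) = 0 ∧
        volume ({z : Fin (1 + d) → ℝ | (fun i => z (Fin.natAdd 1 i)) ∈ B.domain} \ ⋃ j, Ψ j '' S j) = 0 := by
  refine ⟨0, IntegralRep.empty 0, IntegralRep.empty 0, by simp, by simp, by simp, 0, Fin.elim0, Fin.elim0, Fin.elim0,
    fun j => j.elim0, fun j => j.elim0, by simp, by simp⟩

/-- The last coordinate of a stabilised set with at least one padding coordinate lies in `(0,1)`.
[folklore] -/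
theorem last_mem_Ioo_of_mem_stabSet {k D : ℕ} (hk : k ≤ D + 3) (hk2 : k ≤ D + 2) {T : Set (Fin k → ℝ)}
    {y : Fin (D + 3) → ℝ} (hy : y ∈ stabSet hk T) : y (Fin.last (D + 2)) ∈ Ioo (0 : ℝ) 2 := by
  have := (mem_stabSet.mp hy).2 (Fin.last (D + 2)) (by simp; omega)
  exact ⟨this.1, this.2.trans one_lt_two⟩

/-- **STUB `stub_tameForm`** (one-bijection normal form with catalytic spectator, for the Cauchy
catalyst `K = [ℝ, 1/(1+x²)]`; crux NOTES c6 "F13" with absorption of the spectator). [folklore] -/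
theorem stub_tameForm : ∀ ⦃n m : ℕ⦄ (r : IntegralRep n) (r' : IntegralRep m) (K : IntegralRep 1), K.domain = Set.univ → Set.EqOn K.integrand (fun x => 1 / (1 + x 0 ^ 2)) K.domain → of (K.prod r) - of (K.prod r') ∈ relations → ∃ (d : ℕ) (A B : IntegralRep d), (∀ a ∈ A.domain, 0 < A.integrand a) ∧ (∀ b ∈ B.domain, 0 < B.integrand b) ∧ of r - of r' - (of A - of B) ∈ relations ∧ ∃ (J : ℕ) (S : Fin J → Set (Fin (1 + d) → ℝ)) (Ψ : Fin J → (Fin (1 + d) → ℝ) → (Fin (1 + d) → ℝ)) (Ψ' : Fin J → (Fin (1 + d) → ℝ) → ((Fin (1 + d) → ℝ) →L[ℝ] (Fin (1 + d) → ℝ))), (∀ j, IsSemialgebraic ℚ (S j) ∧ S j ⊆ {z | (fun i => z (Fin.natAdd 1 i)) ∈ A.domain} ∧ IsSemialgebraicMapOn ℚ (S j) (Ψ j) ∧ Set.InjOn (Ψ j) (S j) ∧ (∀ z ∈ S j, HasFDerivWithinAt (Ψ j) (Ψ' j z) (S j) z) ∧ Ψ j '' S j ⊆ {z | (fun i =>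 z (Fin.natAdd 1 i)) ∈ B.domain} ∧ ∀ z ∈ S j, 1 / (1 + z (Fin.castAdd d 0) ^ 2) * A.integrand (fun i => z (Fin.natAdd 1 i)) = 1 / (1 + (Ψ j z) (Fin.castAdd d 0) ^ 2) * B.integrand (fun i => (Ψ j z) (Fin.natAdd 1 i)) * |(Ψ' j z).det|) ∧ (∀ j j', j ≠ j' → volume (S j ∩ S j') = 0 ∧ volume (Ψ j '' S j ∩ Ψ j' '' S j') = 0) ∧ volume ({z : Fin (1 + d) → ℝ | (fun i => z (Fin.natAdd 1 i)) ∈ A.domain} \ ⋃ j, S j) = 0 ∧ volume ({z : Fin (1 + d) → ℝ | (fun i => z (Fin.natAdd 1 i)) ∈ B.domain} \ ⋃ j, Ψ j '' S j) = 0 := by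
  intro n m r r' K hKd hKi h
  classical
  by_cases hXY : (⟨1 + n, K.prod r⟩ : Σ k, IntegralRep k) = ⟨1 + m, K.prod r'⟩
  · -- degenerate case: `r = r'`
    have hnm : n = m := by
      have := congrArg Sigma.fst hXY
      simp only at this
      omega
    subst hnm
    have hXY' : K.prod r = K.prod r' := eq_of_heq (Sigma.mk.inj hXY).2
    have hrr := eq_of_prod_eq K hKd hKi r r' hXY'
    subst hrr
    exact tameForm_of_eq r
  -- the shadow of the certificate and the normal form with catalytic cylinders
  obtain ⟨S⟩ := shadow_of_relations h
  obtain ⟨D, hn, hm, hn2, hm2, hD, s, C, hCpos, ⟨mc⟩⟩ := exists_cylinderMIso K hKd hKi r r' S hXY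
  -- the representations of the tails
  obtain ⟨P, hPd, hPi⟩ := exists_posRep r
  obtain ⟨M, hMd, hMi⟩ := exists_negRep r
  obtain ⟨P', hP'd, hP'i⟩ := exists_posRep r'
  obtain ⟨M', hM'd, hM'i⟩ := exists_negRep r'
  obtain ⟨Ps, hPsd, hPsi, hPsr⟩ := exists_stabRep P hn
  obtain ⟨Ms, hMsd, hMsi, hMsr⟩ := exists_stabRep M hn
  obtain ⟨Ps', hPs'd, hPs'i, hPs'r⟩ := exists_stabRep P' hm
  obtain ⟨Ms', hMs'd, hMs'i, hMs'r⟩ := exists_stabRep M' hm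
  have htilde : ∀ k, ∃ Ct : IntegralRep (D + 3), Ct.domain = {y : Fin (D + 3) → ℝ |
      (fun i : Fin (1 + D) => y (Fin.castLE hD i)) ∈ (C k).domain ∧
        y ⟨1 + D, by omega⟩ ∈ Ioo (0 : ℝ) 1 ∧ y (Fin.last (D + 2)) ∈ Ioo (0 : ℝ) 2} ∧
      Ct.integrand = fun y => (C k).integrand (fun i : Fin (1 + D) => y (Fin.castLE hD i)) :=
    fun k => exists_tildeRep D (C k) hD
  choose Ct hCtd hCti using htilde
  let RA : Unit ⊕ (Unit ⊕ (Fin s ⊕ Fin s)) → IntegralRep (D + 2 + 1) :=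
    Sum.elim (fun _ => Ps) (Sum.elim (fun _ => Ms') Ct)
  let RB : Unit ⊕ (Unit ⊕ (Fin s ⊕ Fin s)) → IntegralRep (D + 2 + 1) :=
    Sum.elim (fun _ => Ps') (Sum.elim (fun _ => Ms) Ct)
  have hRApos : ∀ p, ∀ y ∈ (RA p).domain, 0 < (RA p).integrand y := by
    rintro (_ | _ | k) y hy
    · simp only [RA, Sum.elim_inl, hPsd, hPsi, hPd, hPi] at hy ⊢
      exact stabFun_pos_of_mem hn r hy
    · simp only [RA, Sum.elim_inr, Sum.elim_inl, hMs'd, hMs'i, hM'd, hM'i] at hy ⊢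
      exact stabFun_neg_pos_of_mem hm r' hy
    · simp only [RA, Sum.elim_inr, hCtd, hCti, mem_setOf_eq] at hy ⊢
      exact hCpos k _ hy.1
  have hRBpos : ∀ q, ∀ y ∈ (RB q).domain, 0 < (RB q).integrand y := by
    rintro (_ | _ | k) y hy
    · simp only [RB, Sum.elim_inl, hPs'd, hPs'i, hP'd, hP'i] at hy ⊢
      exact stabFun_pos_of_mem hm r' hy
    · simp only [RB, Sum.elim_inr, Sum.elim_inl, hMsd, hMsi, hMd, hMi] at hy ⊢
      exact stabFun_neg_pos_of_mem hn r hy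
    · simp only [RB, Sum.elim_inr, hCtd, hCti, mem_setOf_eq] at hy ⊢
      exact hCpos k _ hy.1
  have hRAl : ∀ p, ∀ y ∈ (RA p).domain, y (Fin.last (D + 2)) ∈ Ioo (0 : ℝ) 2 := by
    rintro (_ | _ | k) y hy
    · simp only [RA, Sum.elim_inl, hPsd] at hy
      exact last_mem_Ioo_of_mem_stabSet hn hn2 hy
    · simp only [RA, Sum.elim_inr, Sum.elim_inl, hMs'd] at hy
      exact last_mem_Ioo_of_mem_stabSet hm hm2 hy
    · simp only [RA, Sum.elim_inr, hCtd, mem_setOf_eq] at hy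
      exact hy.2.2
  have hRBl : ∀ q, ∀ y ∈ (RB q).domain, y (Fin.last (D + 2)) ∈ Ioo (0 : ℝ) 2 := by
    rintro (_ | _ | k) y hy
    · simp only [RB, Sum.elim_inl, hPs'd] at hy
      exact last_mem_Ioo_of_mem_stabSet hm hm2 hy
    · simp only [RB, Sum.elim_inr, Sum.elim_inl, hMsd] at hy
      exact last_mem_Ioo_of_mem_stabSet hn hn2 hy
    · simp only [RB, Sum.elim_inr, hCtd, mem_setOf_eq] at hy
      exact hy.2.2
  -- the normal form as an `MIso` between the cylinders over the tails
  obtain ⟨mi⟩ := mc.copy (σ' := fun p => {w : Fin (1 + (D + 2 + 1)) → ℝ |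
      (fun i : Fin (D + 2 + 1) => w (Fin.natAdd 1 i)) ∈ (RA p).domain})
    (ρ' := fun p w => 1 / (1 + w (Fin.castAdd (D + 2 + 1) 0) ^ 2) *
      (RA p).integrand (fun i : Fin (D + 2 + 1) => w (Fin.natAdd 1 i)))
    (τ' := fun q => {w : Fin (1 + (D + 2 + 1)) → ℝ |
      (fun i : Fin (D + 2 + 1) => w (Fin.natAdd 1 i)) ∈ (RB q).domain})
    (θ' := fun q w => 1 / (1 + w (Fin.castAdd (D + 2 + 1) 0) ^ 2) *
      (RB q).integrand (fun i : Fin (D + 2 + 1) => w (Fin.natAdd 1 i)))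
    (by funext p; rcases p with _ | _ | k
        · simp only [RA, Sum.elim_inl, hPsd, hPd]
        · simp only [RA, Sum.elim_inr, Sum.elim_inl, hMs'd, hM'd]
        · simp only [RA, Sum.elim_inr, hCtd])
    (by funext p; rcases p with _ | _ | k
        · simp only [RA, Sum.elim_inl, hPsi, hPi]
        · simp only [RA, Sum.elim_inr, Sum.elim_inl, hMs'i, hM'i]
        · simp only [RA, Sum.elim_inr, hCti])
    (by funext q; rcases q with _ | _ | k
        · simp only [RB, Sum.elim_inl, hPs'd, hP'd]
        · simp only [RB, Sum.elim_inr, Sum.elim_inl, hMsd, hMd]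
        · simp only [RB, Sum.elim_inr, hCtd])
    (by funext q; rcases q with _ | _ | k
        · simp only [RB, Sum.elim_inl, hPs'i, hP'i]
        · simp only [RB, Sum.elim_inr, Sum.elim_inl, hMsi, hMi]
        · simp only [RB, Sum.elim_inr, hCti])
  obtain ⟨A, B, hApos, hBpos, hAr, hBr, hiso⟩ := realize RA RB hRApos hRBpos hRAl hRBl mi
  refine ⟨D + 2 + 1, A, B, hApos, hBpos, ?_, hiso⟩
  -- the relation `[r] − [r'] ≡ [A] − [B]`
  have hsumA : ∑ p, of (RA p) = of Ps + of Ms' + ∑ k, of (Ct k) := by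
    simp only [RA, Fintype.sum_sum_type, Fintype.sum_unique, Sum.elim_inl, Sum.elim_inr]
    abel
  have hsumB : ∑ q, of (RB q) = of Ps' + of Ms + ∑ k, of (Ct k) := by
    simp only [RB, Fintype.sum_sum_type, Fintype.sum_unique, Sum.elim_inl, Sum.elim_inr]
    abel
  have h1 : of r - (of P - of M) ∈ relations := of_sub_pos_add_neg_mem_relations r P M hPd hPi hMd hMi
  have h2 : of r' - (of P' - of M') ∈ relations := of_sub_pos_add_neg_mem_relations r' P' M' hP'd hP'i hM'd hM'i
  have : of r - of r' - (of A - of B) = (of r - (of P - of M)) - (of r' - (of P' - of M')) +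
      (of P - of Ps) - (of M - of Ms) - (of P' - of Ps') + (of M' - of Ms') -
      (of A - ∑ p, of (RA p)) + (of B - ∑ q, of (RB q)) := by
    rw [hsumA, hsumB]; abel
  rw [this]
  refine relations.add_mem (relations.sub_mem (relations.add_mem (relations.sub_mem (relations.sub_mem
    (relations.add_mem (relations.sub_mem h1 h2) hPsr) hMsr) hPs'r) hMs'r) hAr) hBr

end Summit.KontsevichZagierPeriods.KontsevichZagierPeriods.BetaCancellationDivisorSlicing

end
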